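import Mathlib
import Summits.ValiantsHypothesis.ValiantsHypothesis.Theorems.BarrierLeverDefinableEquationsExplicitCoefficientsGeneric
import Summits.ValiantsHypothesis.ValiantsHypothesis.Theorems.BarrierLeverDefinableEquationsCountingCircuits

/-!
# Crux `BarrierLever.DefinableDcEquations` (stmt-8746) / `DefinableEquations` (stmt-8745) — the
# cruxes from `GapP`-CIRCUIT-EXPLICIT COEFFICIENT FUNCTIONS on the FULL coefficient variables
# (generic counting-circuit bridge; val-np-p5 g7)

`…DefinableEquationsCountingCircuits.lean` gave the counting-circuit interface for equations in the
TOP coefficient variables.  Here the same interface for an arbitrary finite variable type `ι`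
(`CountingCircuitsGeneric.exists_coeffPoly`: two well-formed fan-in-`2` Boolean programs `γ₊, γ₋`
of the tree's `Literature.Computability.Complexity` on `K` input bits — read through a decoding
`dec : Fin K → ι × Fin (D+1)` of the one-hot exponent bits — and `m` certificate bits give the
bits-only polynomial `Q₀ = rename (dec ⊕ id) (certCountPoly γ₊ - certCountPoly γ₋)` whose cube
marginals are `#acc(γ₊, x_μ) - #acc(γ₋, x_μ)`; Bürgisser 2000 TCS §5 (A2)), and the two cruxes on
the full coefficient variables `degLEMonomials n`:

* `definableDcEquations_of_countingCircuits` — crux 8746: a super-quasi-quadratic threshold `m`,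
  one scale `c`, and eventually in `n` a NONZERO `E ∈ ℂ[degLEMonomials n]` vanishing at `coeff f`
  for all `f` with `deg f ≤ n`, `dc f ≤ m(n)`, whose coefficient function is
  `#acc(γ₊, x_μ) - #acc(γ₋, x_μ)` for programs of size `≤ N^c`, imply `DefinableDcEquations`;
* `definableEquations_of_countingCircuits_full` — crux 8745 likewise
  (all `f ∈ SmallCircuits ℂ n b`).

Via `ExplicitCoefficients.boolSum_of_explicit` (scale `c+2` ⇒ level `2c+11`).  A SUFFICIENT
format; both cruxes stay OPEN; nothing here bears on `VP ≠ VNP`.  No definitions, no named facts.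
Refs: P. Bürgisser, TCS 235 (2000) §5 (A2); L. G. Valiant 1979; P. Bürgisser 2000, Prop. 2.20.
-/

set_option linter.dupNamespace false

noncomputable section

namespace Summit.ValiantsHypothesis.ValiantsHypothesis.Theorems.BarrierLeverDefinableEquations

open MvPolynomial Literature.Computability.AlgebraicComplexity
open Literature.Barriers.ValiantsHypothesis
open Literature.Computability.Complexity Literature.Computability.Complexity.GateList
open scoped BigOperators

namespace CountingCircuitsGeneric

variable {ι : Type*} {D K m U P : ℕ}

/-- **The bits-only polynomial of a pair of counting circuits (generic variable type).**  For
well-formed fan-in-`2` programs `γ₊, γ₋` on `K` input and `m` certificate bits (`m ≤ P`,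
`P + |γ| ≤ U`) and a decoding `dec : Fin K → ι × Fin (D+1)`, the polynomial
`Q₀ = rename (dec ⊕ id) (certCountPoly γ₊ - certCountPoly γ₋)` has cube marginal
`#acc(γ₊, x_μ) - #acc(γ₋, x_μ)` at the one-hot point of every `μ : ι →₀ ℕ` (`x_μ = oneHot μ ∘ dec`),
`L(Q₀) ≤ 134 U + 13`, `deg Q₀ ≤ 8 U + 4`. [cite: Burgisser2000TCS, §5 (A2) pp. 84–85] -/
theorem exists_coeffPoly (dec : Fin K → ι × Fin (D + 1))
    (gs₁ gs₂ : List (Gate (Fin K ⊕ Fin m))) (out₁ out₂ : (Fin K ⊕ Fin m) ⊕ ℕ)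
    (hwf₁ : WF gs₁) (hwf₂ : WF gs₂) (hB₁ : ∀ g ∈ gs₁, g.arity ≤ 2) (hB₂ : ∀ g ∈ gs₂, g.arity ≤ 2)
    (hout₁ : ∀ j, out₁ = .inr j → j < gs₁.length) (hout₂ : ∀ j, out₂ = .inr j → j < gs₂.length)
    (hm : m ≤ P) (hs₁ : P + gs₁.length ≤ U) (hs₂ : P + gs₂.length ≤ U) :
    ∃ Q₀ : MvPolynomial ((ι × Fin (D + 1)) ⊕ Fin (U + 1)) ℂ,
      complexity Q₀ ≤ 134 * U + 13 ∧ Q₀.totalDegree ≤ 8 * U + 4 ∧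
      ∀ μ : ι →₀ ℕ,
        (∑ w : Fin (U + 1) → Bool, eval (fun x => if Sum.elim
            (fun p : ι × Fin (D + 1) => decide (μ p.1 = (p.2 : ℕ))) w x
            then (1 : ℂ) else 0) Q₀) =
          (((Finset.univ.filter fun y : Fin m → Bool =>
              wireOf (Sum.elim (fun k => decide (μ (dec k).1 = ((dec k).2 : ℕ))) y)
                (vals gs₁ (Sum.elim (fun k => decide (μ (dec k).1 = ((dec k).2 : ℕ))) y)) out₁ =
                true).card : ℕ) : ℂ) -
          (((Finset.univ.filter fun y : Fin m → Bool =>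
              wireOf (Sum.elim (fun k => decide (μ (dec k).1 = ((dec k).2 : ℕ))) y)
                (vals gs₂ (Sum.elim (fun k => decide (μ (dec k).1 = ((dec k).2 : ℕ))) y)) out₂ =
                true).card : ℕ) : ℂ) := by
  classical
  refine ⟨rename (Sum.map dec id)
      (certCountPoly (k := ℂ) K m U P gs₁ out₁ - certCountPoly (k := ℂ) K m U P gs₂ out₂),
    ?_, ?_, fun μ => ?_⟩
  · refine (complexity_rename_le_holds' _ _).trans ?_
    have h1 := complexity_certCountPoly_le (k := ℂ) (n := K) (m := m) hB₁ hs₁ out₁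
    have h2 := complexity_certCountPoly_le (k := ℂ) (n := K) (m := m) hB₂ hs₂ out₂
    have h3 : complexity (certCountPoly (k := ℂ) K m U P gs₁ out₁ -
        certCountPoly (k := ℂ) K m U P gs₂ out₂) ≤
        complexity (certCountPoly (k := ℂ) K m U P gs₁ out₁) +
          complexity (certCountPoly (k := ℂ) K m U P gs₂ out₂) + 2 := by
      rw [sub_eq_add_neg]
      refine (complexity_add_le_holds _ _).trans ?_
      have h4 : complexity (-certCountPoly (k := ℂ) K m U P gs₂ out₂) ≤
          complexity (certCountPoly (k := ℂ) K m U P gs₂ out₂) + 1 := by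
        rw [show -certCountPoly (k := ℂ) K m U P gs₂ out₂ =
            C (-1) * certCountPoly (k := ℂ) K m U P gs₂ out₂ by rw [map_neg, map_one]; ring]
        have h5 := complexity_mul_le_holds (C (-1) : MvPolynomial (Fin K ⊕ Fin (U + 1)) ℂ)
          (certCountPoly (k := ℂ) K m U P gs₂ out₂)
        have h6 := complexity_C_holds (σ := Fin K ⊕ Fin (U + 1)) (-1 : ℂ)
        omega
      omega
    omega
  · refine (totalDegree_rename_le _ _).trans ((totalDegree_sub _ _).trans (max_le ?_ ?_))
    · exact (totalDegree_certCountPoly_le (k := ℂ) hB₁ hs₁ out₁).trans (by omega)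
    · exact (totalDegree_certCountPoly_le (k := ℂ) hB₂ hs₂ out₂).trans (by omega)
  · set xμ : Fin K → Bool := fun k => decide (μ (dec k).1 = ((dec k).2 : ℕ)) with hxμ
    have hpt : ∀ w : Fin (U + 1) → Bool, ((fun x => if Sum.elim
        (fun p : ι × Fin (D + 1) => decide (μ p.1 = (p.2 : ℕ))) w x
        then (1 : ℂ) else 0) ∘ Sum.map dec id) = boolPoint ℂ (Sum.elim xμ w) := by
      intro w
      funext x
      rcases x with k | j
      · simp [boolPoint, xμ]
      · simp [boolPoint]
    simp_rw [eval_rename, hpt, map_sub]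
    rw [Finset.sum_sub_distrib, sum_eval_certCountPoly hwf₁ hout₁ hm hs₁ xμ,
      sum_eval_certCountPoly hwf₂ hout₂ hm hs₂ xμ]

/-- `13 ≤ C(2n,n)` and `|degLEMonomials n| ≤ C(2n,n)` for `n ≥ 3`. [folklore] -/
theorem budget {n : ℕ} (hn : 3 ≤ n) [Fintype ↥(degLEMonomials n)] :
    13 ≤ Nat.choose (2 * n) n ∧ Fintype.card ↥(degLEMonomials n) ≤ Nat.choose (2 * n) n := by
  refine ⟨?_, (ExplicitCoefficients.budget (le_trans (by norm_num) hn)).2⟩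
  have h6 : Nat.choose (2 * 3) 3 ≤ Nat.choose (2 * n) n := by
    calc Nat.choose (2 * 3) 3 ≤ Nat.choose (2 * 3 + (2 * n - 2 * 3)) 3 :=
          Nat.choose_mono _ (by omega)
      _ = Nat.choose (2 * n) 3 := by rw [Nat.add_sub_cancel' (by omega)]
      _ ≤ Nat.choose (2 * n) n := Nat.choose_le_middle 3 (2 * n) |>.trans (by
          rw [Nat.mul_div_cancel_left n Nat.two_pos])
  have : Nat.choose (2 * 3) 3 = 20 := by decide
  omega

/-- **Counting-circuit coefficient function ⇒ Boolean-sum witness, for any property `V`** on the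
full coefficient variables (`n ≥ 3`; scale `c` ⇒ level `2c + 11`).
[cite: Burgisser2000TCS, §5 (A2) pp. 84–85] -/
theorem boolSum_of_countingCircuits {c n : ℕ} (hn : 3 ≤ n)
    (V : MvPolynomial ↥(degLEMonomials n) ℂ → Prop)
    (h : ∃ D K m U P : ℕ, D ≤ (Nat.choose (2 * n) n) ^ c ∧ U ≤ (Nat.choose (2 * n) n) ^ c ∧
      ∃ (dec : Fin K → ↥(degLEMonomials n) × Fin (D + 1))
        (gs₁ gs₂ : List (Gate (Fin K ⊕ Fin m))) (out₁ out₂ : (Fin K ⊕ Fin m) ⊕ ℕ),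
        WF gs₁ ∧ WF gs₂ ∧ (∀ g ∈ gs₁, g.arity ≤ 2) ∧ (∀ g ∈ gs₂, g.arity ≤ 2) ∧
        (∀ j, out₁ = .inr j → j < gs₁.length) ∧ (∀ j, out₂ = .inr j → j < gs₂.length) ∧
        m ≤ P ∧ P + gs₁.length ≤ U ∧ P + gs₂.length ≤ U ∧
        ∃ E : MvPolynomial ↥(degLEMonomials n) ℂ, E ≠ 0 ∧ V E ∧
          (∀ μ ∈ E.support, ∀ e, μ e ≤ D) ∧
          ∀ μ : ↥(degLEMonomials n) →₀ ℕ, (∀ e, μ e ≤ D) → coeff μ E =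
            (((Finset.univ.filter fun y : Fin m → Bool =>
                wireOf (Sum.elim (fun k => decide (μ (dec k).1 = ((dec k).2 : ℕ))) y)
                  (vals gs₁ (Sum.elim (fun k => decide (μ (dec k).1 = ((dec k).2 : ℕ))) y)) out₁ =
                  true).card : ℕ) : ℂ) -
            (((Finset.univ.filter fun y : Fin m → Bool =>
                wireOf (Sum.elim (fun k => decide (μ (dec k).1 = ((dec k).2 : ℕ))) y)
                  (vals gs₂ (Sum.elim (fun k => decide (μ (dec k).1 = ((dec k).2 : ℕ))) y)) out₂ =
                  true).card : ℕ) : ℂ)) :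
    ∃ q : ℕ, q ≤ (Nat.choose (2 * n) n) ^ (2 * (c + 2) + 7) ∧
      ∃ H : MvPolynomial (↥(degLEMonomials n) ⊕ Fin q) ℂ,
        complexity H ≤ (Nat.choose (2 * n) n) ^ (2 * (c + 2) + 7) ∧
        H.totalDegree ≤ (Nat.choose (2 * n) n) ^ (2 * (c + 2) + 7) ∧
        boolSum H ≠ 0 ∧ V (boolSum H) := by
  classical
  haveI : Fintype ↥(degLEMonomials n) := (Finsupp.finite_of_degree_le (σ := Fin n) n).fintype
  obtain ⟨D, K, m, U, P, hD, hU, dec, gs₁, gs₂, out₁, out₂, hwf₁, hwf₂, hB₁, hB₂, hout₁, hout₂,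
    hm, hs₁, hs₂, E, hE0, hV, hsupp, hcoeff⟩ := h
  obtain ⟨Q₀, hQc, hQd, hmarg⟩ :=
    exists_coeffPoly dec gs₁ gs₂ out₁ out₂ hwf₁ hwf₂ hB₁ hB₂ hout₁ hout₂ hm hs₁ hs₂
  obtain ⟨hN, hI⟩ := budget hn
  obtain ⟨hD', hr', hL', hd'⟩ := CountingCircuits.arith (c := c) hN hD hU
  exact ExplicitCoefficients.boolSum_of_explicit (by omega) hI V
    ⟨D, U + 1, hD', hr', Q₀, hQc.trans hL', hQd.trans hd', E, hE0, hV, hsupp,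
      fun μ hμ => by rw [hcoeff μ hμ, hmarg μ]⟩

end CountingCircuitsGeneric

open CountingCircuitsGeneric

/-- **Crux 8746 from `GapP`-circuit-explicit coefficient functions.**  A super-quasi-quadratic
threshold `m`, one scale `c`, and — eventually in `n` — counting programs `γ₊, γ₋` of size
`≤ N^c` with a NONZERO `E ∈ ℂ[degLEMonomials n]` of coefficient function
`#acc(γ₊, x_μ) - #acc(γ₋, x_μ)` (exponents `≤ D ≤ N^c`) vanishing at `coeff f` whenever
`deg f ≤ n` and `dc f ≤ m(n)`, give `DefinableDcEquations` (level `2c + 11`).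
[cite: Burgisser2000TCS, §5 (A2) pp. 84–85] -/
theorem definableDcEquations_of_countingCircuits
    (h : ∃ m : ℕ → ℕ, (∀ C : ℕ, ∃ n₀ : ℕ, ∀ n ≥ n₀, 2 ^ (C * (Nat.log 2 n + 1) ^ 2) ≤ m n) ∧
      ∃ c n₀ : ℕ, ∀ n ≥ n₀,
      ∃ D K mc U P : ℕ, D ≤ (Nat.choose (2 * n) n) ^ c ∧ U ≤ (Nat.choose (2 * n) n) ^ c ∧
      ∃ (dec : Fin K → ↥(degLEMonomials n) × Fin (D + 1))
        (gs₁ gs₂ : List (Gate (Fin K ⊕ Fin mc))) (out₁ out₂ : (Fin K ⊕ Fin mc) ⊕ ℕ),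
        WF gs₁ ∧ WF gs₂ ∧ (∀ g ∈ gs₁, g.arity ≤ 2) ∧ (∀ g ∈ gs₂, g.arity ≤ 2) ∧
        (∀ j, out₁ = .inr j → j < gs₁.length) ∧ (∀ j, out₂ = .inr j → j < gs₂.length) ∧
        mc ≤ P ∧ P + gs₁.length ≤ U ∧ P + gs₂.length ≤ U ∧
        ∃ E : MvPolynomial ↥(degLEMonomials n) ℂ, E ≠ 0 ∧
          (∀ f : MvPolynomial (Fin n) ℂ, f.totalDegree ≤ n →
            determinantalComplexity f ≤ m n →
              eval (coeffVector (degLEMonomials n) f) E = 0) ∧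
          (∀ μ ∈ E.support, ∀ e, μ e ≤ D) ∧
          ∀ μ : ↥(degLEMonomials n) →₀ ℕ, (∀ e, μ e ≤ D) → coeff μ E =
            (((Finset.univ.filter fun y : Fin mc → Bool =>
                wireOf (Sum.elim (fun k => decide (μ (dec k).1 = ((dec k).2 : ℕ))) y)
                  (vals gs₁ (Sum.elim (fun k => decide (μ (dec k).1 = ((dec k).2 : ℕ))) y)) out₁ =
                  true).card : ℕ) : ℂ) -
            (((Finset.univ.filter fun y : Fin mc → Bool =>
                wireOf (Sum.elim (fun k => decide (μ (dec k).1 = ((dec k).2 : ℕ))) y)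
                  (vals gs₂ (Sum.elim (fun k => decide (μ (dec k).1 = ((dec k).2 : ℕ))) y)) out₂ =
                  true).card : ℕ) : ℂ)) :
    Summit.ValiantsHypothesis.ValiantsHypothesis.Theses.BarrierLever.DefinableDcEquations := by
  obtain ⟨m, hgrow, c, n₀, hc⟩ := h
  refine ⟨m, hgrow, 2 * (c + 2) + 7, max n₀ 3, fun n hn => ?_⟩
  exact boolSum_of_countingCircuits (le_trans (le_max_right _ _) hn)
    (fun E => ∀ f : MvPolynomial (Fin n) ℂ, f.totalDegree ≤ n →
      determinantalComplexity f ≤ m n → eval (coeffVector (degLEMonomials n) f) E = 0)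
    (hc n (le_trans (le_max_left _ _) hn))

/-- **Crux 8745 from `GapP`-circuit-explicit coefficient functions on the full coefficient
variables** (one scale `c` for every `b`; level `2c + 11`).
[cite: Burgisser2000TCS, §5 (A2) pp. 84–85] -/
theorem definableEquations_of_countingCircuits_full
    (h : ∃ c : ℕ, ∀ b : ℕ, ∃ n₀ : ℕ, ∀ n ≥ n₀,
      ∃ D K mc U P : ℕ, D ≤ (Nat.choose (2 * n) n) ^ c ∧ U ≤ (Nat.choose (2 * n) n) ^ c ∧
      ∃ (dec : Fin K → ↥(degLEMonomials n) × Fin (D + 1))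
        (gs₁ gs₂ : List (Gate (Fin K ⊕ Fin mc))) (out₁ out₂ : (Fin K ⊕ Fin mc) ⊕ ℕ),
        WF gs₁ ∧ WF gs₂ ∧ (∀ g ∈ gs₁, g.arity ≤ 2) ∧ (∀ g ∈ gs₂, g.arity ≤ 2) ∧
        (∀ j, out₁ = .inr j → j < gs₁.length) ∧ (∀ j, out₂ = .inr j → j < gs₂.length) ∧
        mc ≤ P ∧ P + gs₁.length ≤ U ∧ P + gs₂.length ≤ U ∧
        ∃ E : MvPolynomial ↥(degLEMonomials n) ℂ, E ≠ 0 ∧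
          (∀ f ∈ SmallCircuits ℂ n b, eval (coeffVector (degLEMonomials n) f) E = 0) ∧
          (∀ μ ∈ E.support, ∀ e, μ e ≤ D) ∧
          ∀ μ : ↥(degLEMonomials n) →₀ ℕ, (∀ e, μ e ≤ D) → coeff μ E =
            (((Finset.univ.filter fun y : Fin mc → Bool =>
                wireOf (Sum.elim (fun k => decide (μ (dec k).1 = ((dec k).2 : ℕ))) y)
                  (vals gs₁ (Sum.elim (fun k => decide (μ (dec k).1 = ((dec k).2 : ℕ))) y)) out₁ =
                  true).card : ℕ) : ℂ) -
            (((Finset.univ.filter fun y : Fin mc → Bool =>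
                wireOf (Sum.elim (fun k => decide (μ (dec k).1 = ((dec k).2 : ℕ))) y)
                  (vals gs₂ (Sum.elim (fun k => decide (μ (dec k).1 = ((dec k).2 : ℕ))) y)) out₂ =
                  true).card : ℕ) : ℂ)) :
    Summit.ValiantsHypothesis.ValiantsHypothesis.Theses.BarrierLever.DefinableEquations := by
  obtain ⟨c, hc⟩ := h
  refine ⟨2 * (c + 2) + 7, fun b => ?_⟩
  obtain ⟨n₀, hn₀⟩ := hc b
  refine ⟨max n₀ 3, fun n hn => ?_⟩
  exact boolSum_of_countingCircuits (le_trans (le_max_right _ _) hn)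
    (fun E => ∀ f ∈ SmallCircuits ℂ n b, eval (coeffVector (degLEMonomials n) f) E = 0)
    (hn₀ n (le_trans (le_max_left _ _) hn))

end Summit.ValiantsHypothesis.ValiantsHypothesis.Theorems.BarrierLeverDefinableEquations

end
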